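import Literature.MathematicalPhysics.QuantumLattice.SpinSystemProofs
import Literature.MathematicalPhysics.QuantumLattice.ProductOperators
import Literature.MathematicalPhysics.QuantumLattice.HeisenbergModel
import Literature.MathematicalPhysics.QuantumLattice.Z2GaugeHiggsTorus
import Literature.MathematicalPhysics.QuantumLattice.XYOrderInfraredProofs
import HarnessLib

/-!
# Spin ½: the exchange bound `𝐒_x·𝐒_y ≤ ¼` and the Casimir bound `(Σ_{x∈Y} 𝐒_x)² ≤ (|Y|/2)(|Y|/2 + 1)`

Trunk T-QLATTICE. Operator inequalities (Loewner order, as `Matrix.PosSemidef` of differences) for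
finitely many spins ½ inside an arbitrary finite spin system `Op Λ 2`:

* single-site Pauli algebra at a site: `(Sᵅ_x)² = ¼`, `Sˣ_xSʸ_x = (i/2)Sᶻ_x` and cyclic
  (`siteSpin_one_mul_self`, `siteSpin_one_mul_next`, `siteSpin_one_mul_prev`);
* the two-spin identity `(𝐒_x·𝐒_y)² = 3/16 - ½ 𝐒_x·𝐒_y` for `x ≠ y` (`spinExchange_sq`), whence
  `Q = ¼ - 𝐒_x·𝐒_y` is an orthogonal projection (the singlet projection) and
  **`𝐒_x·𝐒_y ≤ ¼`** (`posSemidef_quarter_sub_spinExchange`; Dirac's exchange identity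
  `𝐒_x·𝐒_y = ½P_{xy} - ¼` in disguise);
* **the Casimir upper bound** for the total spin `𝐋 = Σ_{x∈Y} 𝐒_x` of a finite set `Y` of
  spins ½: `𝐋² ≤ (k/2)(k/2+1)`, `k = |Y|`, i.e. `((k(k+2)/4)·1 - 𝐋²).PosSemidef`
  (`posSemidef_casimirBound_sub`): `𝐋² = ¾k + Σ_{x≠y} 𝐒_x·𝐒_y ≤ ¾k + ¼k(k-1)`.

These are the inputs of Anderson's cluster lower bounds for ground-state energies
(`AndersonClusterBound.lean`). Tasaki (2020) §2.1–2.2, App. A.3; Lieb–Mattis (1962).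

## References

* [Tasaki2020] H. Tasaki, *Physics and Mathematics of Quantum Many-Body Systems*, Springer (2020),
  §2.1 eq. (2.1.8) (Pauli algebra), §2.2, App. A.3 (addition of angular momenta).
* [Anderson1951] P. W. Anderson, *Limits on the energy of the antiferromagnetic ground state*,
  Phys. Rev. 83 (1951) 1260.
-/

noncomputable section

open Matrix Complex Finset
open scoped ComplexOrder

namespace Literature.MathematicalPhysics.QuantumLattice

/-! ### Pauli products -/

section Pauli

/-- `σˣσʸ = iσᶻ`. Tasaki (2020) §2.1, eq. (2.1.8). [cite: Tasaki2020] -/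
theorem spinHalfPauli_zero_mul_one : spinHalfPauli 0 * spinHalfPauli 1 = I • spinHalfPauli 2 := by
  ext a b
  fin_cases a <;> fin_cases b <;> simp [spinHalfPauli, Matrix.mul_apply]

/-- `σʸσˣ = -iσᶻ`. Tasaki (2020) §2.1, eq. (2.1.8). [cite: Tasaki2020] -/
theorem spinHalfPauli_one_mul_zero : spinHalfPauli 1 * spinHalfPauli 0 = -(I • spinHalfPauli 2) := by
  ext a b
  fin_cases a <;> fin_cases b <;> simp [spinHalfPauli, Matrix.mul_apply]

/-- `σʸσᶻ = iσˣ`. Tasaki (2020) §2.1, eq. (2.1.8). [cite: Tasaki2020] -/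
theorem spinHalfPauli_one_mul_two : spinHalfPauli 1 * spinHalfPauli 2 = I • spinHalfPauli 0 := by
  ext a b
  fin_cases a <;> fin_cases b <;> simp [spinHalfPauli, Matrix.mul_apply]

/-- `σᶻσʸ = -iσˣ`. Tasaki (2020) §2.1, eq. (2.1.8). [cite: Tasaki2020] -/
theorem spinHalfPauli_two_mul_one : spinHalfPauli 2 * spinHalfPauli 1 = -(I • spinHalfPauli 0) := by
  ext a b
  fin_cases a <;> fin_cases b <;> simp [spinHalfPauli, Matrix.mul_apply]

/-- `σᶻσˣ = iσʸ`. Tasaki (2020) §2.1, eq. (2.1.8). [cite: Tasaki2020] -/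
theorem spinHalfPauli_two_mul_zero : spinHalfPauli 2 * spinHalfPauli 0 = I • spinHalfPauli 1 := by
  ext a b
  fin_cases a <;> fin_cases b <;> simp [spinHalfPauli, Matrix.mul_apply]

/-- `σˣσᶻ = -iσʸ`. Tasaki (2020) §2.1, eq. (2.1.8). [cite: Tasaki2020] -/
theorem spinHalfPauli_zero_mul_two : spinHalfPauli 0 * spinHalfPauli 2 = -(I • spinHalfPauli 1) := by
  ext a b
  fin_cases a <;> fin_cases b <;> simp [spinHalfPauli, Matrix.mul_apply]

end Pauli

/-! ### Single-site spin-½ algebra inside `Op Λ 2` -/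

section Site

variable {Λ : Type*} [Fintype Λ] [DecidableEq Λ]

/-- `Sᵅ_x Sᵝ_x = onSite x (SᵅSᵝ) = ¼ onSite x (σᵅσᵝ)` for spin ½. [folklore] -/
theorem siteSpin_one_mul_siteSpin_one (x : Λ) (α β : Fin 3) :
    (siteSpin 1 x α * siteSpin 1 x β : Op Λ 2) =
      (1 / 4 : ℂ) • onSite x (spinHalfPauli α * spinHalfPauli β) := by
  rw [siteSpin, siteSpin, onSite_mul, spinVec_one_eq_half_spinHalfPauli,
    spinVec_one_eq_half_spinHalfPauli, smul_mul_smul_comm, onSite_smul']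
  norm_num

/-- `Sᵅ_x = ½ onSite x σᵅ` for spin ½. [folklore] -/
theorem siteSpin_one_eq (x : Λ) (α : Fin 3) :
    (siteSpin 1 x α : Op Λ 2) = (1 / 2 : ℂ) • onSite x (spinHalfPauli α) := by
  rw [siteSpin, spinVec_one_eq_half_spinHalfPauli, onSite_smul']

/-- **`(Sᵅ_x)² = ¼`** for spin ½. Tasaki (2020) §2.1, eq. (2.1.8). [cite: Tasaki2020] -/
theorem siteSpin_one_mul_self (x : Λ) (α : Fin 3) :
    (siteSpin 1 x α * siteSpin 1 x α : Op Λ 2) = (1 / 4 : ℂ) • 1 := by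
  rw [siteSpin_one_mul_siteSpin_one, Z2GaugeHiggs.spinHalfPauli_mul_self, onSite_one']

/-- `Sˣ_xSʸ_x = (i/2)Sᶻ_x` for spin ½. Tasaki (2020) §2.1, eq. (2.1.8). [cite: Tasaki2020] -/
theorem siteSpin_one_x_mul_y (x : Λ) :
    (siteSpin 1 x 0 * siteSpin 1 x 1 : Op Λ 2) = (I / 2) • siteSpin 1 x 2 := by
  rw [siteSpin_one_mul_siteSpin_one, spinHalfPauli_zero_mul_one, onSite_smul', siteSpin_one_eq,
    smul_smul, smul_smul]
  congr 1
  ring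

/-- `Sʸ_xSˣ_x = -(i/2)Sᶻ_x` for spin ½. Tasaki (2020) §2.1, eq. (2.1.8). [cite: Tasaki2020] -/
theorem siteSpin_one_y_mul_x (x : Λ) :
    (siteSpin 1 x 1 * siteSpin 1 x 0 : Op Λ 2) = -((I / 2) • siteSpin 1 x 2) := by
  rw [siteSpin_one_mul_siteSpin_one, spinHalfPauli_one_mul_zero, onSite_neg', onSite_smul',
    siteSpin_one_eq, smul_smul, smul_neg, smul_smul]
  congr 2
  ring

/-- `Sʸ_xSᶻ_x = (i/2)Sˣ_x` for spin ½. Tasaki (2020) §2.1, eq. (2.1.8). [cite: Tasaki2020] -/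
theorem siteSpin_one_y_mul_z (x : Λ) :
    (siteSpin 1 x 1 * siteSpin 1 x 2 : Op Λ 2) = (I / 2) • siteSpin 1 x 0 := by
  rw [siteSpin_one_mul_siteSpin_one, spinHalfPauli_one_mul_two, onSite_smul', siteSpin_one_eq,
    smul_smul, smul_smul]
  congr 1
  ring

/-- `Sᶻ_xSʸ_x = -(i/2)Sˣ_x` for spin ½. Tasaki (2020) §2.1, eq. (2.1.8). [cite: Tasaki2020] -/
theorem siteSpin_one_z_mul_y (x : Λ) :
    (siteSpin 1 x 2 * siteSpin 1 x 1 : Op Λ 2) = -((I / 2) • siteSpin 1 x 0) := by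
  rw [siteSpin_one_mul_siteSpin_one, spinHalfPauli_two_mul_one, onSite_neg', onSite_smul',
    siteSpin_one_eq, smul_smul, smul_neg, smul_smul]
  congr 2
  ring

/-- `Sᶻ_xSˣ_x = (i/2)Sʸ_x` for spin ½. Tasaki (2020) §2.1, eq. (2.1.8). [cite: Tasaki2020] -/
theorem siteSpin_one_z_mul_x (x : Λ) :
    (siteSpin 1 x 2 * siteSpin 1 x 0 : Op Λ 2) = (I / 2) • siteSpin 1 x 1 := by
  rw [siteSpin_one_mul_siteSpin_one, spinHalfPauli_two_mul_zero, onSite_smul', siteSpin_one_eq,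
    smul_smul, smul_smul]
  congr 1
  ring

/-- `Sˣ_xSᶻ_x = -(i/2)Sʸ_x` for spin ½. Tasaki (2020) §2.1, eq. (2.1.8). [cite: Tasaki2020] -/
theorem siteSpin_one_x_mul_z (x : Λ) :
    (siteSpin 1 x 0 * siteSpin 1 x 2 : Op Λ 2) = -((I / 2) • siteSpin 1 x 1) := by
  rw [siteSpin_one_mul_siteSpin_one, spinHalfPauli_zero_mul_two, onSite_neg', onSite_smul',
    siteSpin_one_eq, smul_smul, smul_neg, smul_smul]
  congr 2
  ring

end Site


/-! ### Two spins ½: `(𝐒_x·𝐒_y)² = 3/16 - ½ 𝐒_x·𝐒_y` and `𝐒_x·𝐒_y ≤ ¼` -/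

section Pair

variable {Λ : Type*} [Fintype Λ] [DecidableEq Λ]

/-- For `x ≠ y`, `𝐒_x·𝐒_y = Σ_α Sᵅ_x Sᵅ_y`. Tasaki (2020) §2.4, eq. (2.4.1). [folklore] -/
theorem spinDot_eq_sum_mul_of_ne (n : ℕ) {x y : Λ} (hxy : x ≠ y) :
    spinDot n x y = ∑ α : Fin 3, siteSpin n x α * siteSpin n y α := by
  unfold spinDot
  exact Finset.sum_congr rfl fun α _ => spinBond_eq_mul_of_ne hxy α

/-- Reordering a product of two pair terms at distinct sites:
`(Sᵅ_xSᵅ_y)(Sᵝ_xSᵝ_y) = (Sᵅ_xSᵝ_x)(Sᵅ_ySᵝ_y)`. [folklore] -/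
theorem siteSpin_pair_mul_pair (n : ℕ) {x y : Λ} (hxy : x ≠ y) (α β : Fin 3) :
    (siteSpin n x α * siteSpin n y α) * (siteSpin n x β * siteSpin n y β) =
      (siteSpin n x α * siteSpin n x β) * (siteSpin n y α * siteSpin n y β) := by
  have hc := (siteSpin_commute_of_ne_holds n hxy β α).eq
  -- `S_x β * S_y α = S_y α * S_x β`
  simp only [Matrix.mul_assoc]
  rw [← Matrix.mul_assoc (siteSpin n y α), ← hc, Matrix.mul_assoc]

/-- **The two-spin-½ identity** `(𝐒_x·𝐒_y)² = 3/16 - ½ 𝐒_x·𝐒_y` (`x ≠ y`): from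
`Sᵅ_xSᵝ_x = ¼δ_{αβ} + (i/2)ε_{αβγ}Sᵞ_x` at each site (equivalently `(σ·σ')² = 3 - 2σ·σ'`).
Tasaki (2020) §2.1, App. A.3; Dirac's exchange identity. [cite: Tasaki2020] -/
theorem spinDot_one_mul_self {x y : Λ} (hxy : x ≠ y) :
    (spinDot 1 x y * spinDot 1 x y : Op Λ 2) = (3 / 16 : ℂ) • 1 - (1 / 2 : ℂ) • spinDot 1 x y := by
  rw [spinDot_eq_sum_mul_of_ne 1 hxy, Fin.sum_univ_three]
  simp only [Matrix.add_mul, Matrix.mul_add, siteSpin_pair_mul_pair 1 hxy]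
  simp only [siteSpin_one_mul_self, siteSpin_one_x_mul_y, siteSpin_one_y_mul_x,
    siteSpin_one_y_mul_z, siteSpin_one_z_mul_y, siteSpin_one_z_mul_x, siteSpin_one_x_mul_z,
    Matrix.smul_mul, Matrix.mul_smul, Matrix.neg_mul, Matrix.mul_neg, neg_neg, smul_smul,
    Matrix.one_mul, smul_add, smul_neg]
  have hI : I / 2 * (I / 2) = -(1 / 4 : ℂ) := by
    rw [div_mul_div_comm, I_mul_I]; norm_num
  simp only [hI, neg_smul]
  module

/-- **The exchange bound `𝐒_x·𝐒_y ≤ ¼` for two spins ½** (`x ≠ y`): `Q = ¼ - 𝐒_x·𝐒_y` satisfies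
`Q² = Q = Qᴴ` (it is the singlet projection `½(1 - P_{xy})`), hence `Q = QᴴQ ⪰ 0`.
Tasaki (2020) §2.4, App. A.3 (the two-spin problem); Anderson (1951). [cite: Tasaki2020] -/
theorem posSemidef_quarter_sub_spinDot_one {x y : Λ} (hxy : x ≠ y) :
    ((1 / 4 : ℂ) • (1 : Op Λ 2) - spinDot 1 x y).PosSemidef := by
  set Q : Op Λ 2 := (1 / 4 : ℂ) • 1 - spinDot 1 x y with hQ
  have hQh : Qᴴ = Q := by
    rw [hQ, conjTranspose_sub, conjTranspose_smul, conjTranspose_one, (spinDot_isHermitian 1 x y).eq]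
    congr 1
    norm_num [Complex.star_def]
  have hQQ : Q * Q = Q := by
    rw [hQ, Matrix.sub_mul, Matrix.mul_sub, Matrix.mul_sub, Matrix.smul_mul, Matrix.mul_smul,
      Matrix.mul_smul, Matrix.one_mul, Matrix.mul_one, Matrix.smul_mul, Matrix.one_mul,
      spinDot_one_mul_self hxy, smul_smul]
    module
  have h : Q = Qᴴ * Q := by rw [hQh, hQQ]
  rw [h]
  exact posSemidef_conjTranspose_mul_self Q

end Pair

/-! ### The Casimir bound for a finite set of spins ½ -/

section Casimir

variable {Λ : Type*} [Fintype Λ] [DecidableEq Λ]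

/-- **Expansion of `𝐋²`** for spins ½: `Σ_α (L^α)² = ¾|Y|·1 + Σ_{x∈Y} Σ_{y∈Y, y≠x} 𝐒_x·𝐒_y`.
Tasaki (2020) App. A.3. [folklore] -/
theorem sum_setSpin_one_mul_self (Y : Finset Λ) :
    (∑ α : Fin 3, (∑ x ∈ Y, siteSpin 1 x α) * (∑ x ∈ Y, siteSpin 1 x α) : Op Λ 2) =
      ((3 / 4 : ℂ) * Y.card) • 1 + ∑ x ∈ Y, ∑ y ∈ Y.erase x, spinDot 1 x y := by
  have hexp : ∀ α : Fin 3, ((∑ x ∈ Y, siteSpin 1 x α) * (∑ x ∈ Y, siteSpin 1 x α) : Op Λ 2) =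
      ∑ x ∈ Y, ∑ y ∈ Y, siteSpin 1 x α * siteSpin 1 y α := by
    intro α
    rw [Finset.sum_mul]
    exact Finset.sum_congr rfl fun x _ => Finset.mul_sum _ _ _
  simp only [hexp]
  rw [Finset.sum_comm]
  -- split off the diagonal `y = x`
  have hsplit : ∀ x ∈ Y, (∑ α : Fin 3, ∑ y ∈ Y, siteSpin 1 x α * siteSpin 1 y α : Op Λ 2) =
      (3 / 4 : ℂ) • 1 + ∑ y ∈ Y.erase x, spinDot 1 x y := by
    intro x hx
    rw [Finset.sum_comm]
    rw [← Finset.add_sum_erase Y _ hx]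
    congr 1
    · rw [Fin.sum_univ_three, siteSpin_one_mul_self, siteSpin_one_mul_self, siteSpin_one_mul_self,
        ← add_smul, ← add_smul]
      norm_num
    · refine Finset.sum_congr rfl fun y hy => ?_
      rw [spinDot_eq_sum_mul_of_ne 1 (Finset.ne_of_mem_erase hy).symm]
  rw [Finset.sum_congr rfl hsplit, Finset.sum_add_distrib, Finset.sum_const, ← Nat.cast_smul_eq_nsmul ℂ,
    smul_smul, mul_comm]

/-- A finite sum of positive semidefinite matrices is positive semidefinite. [folklore] -/
theorem posSemidef_finset_sum {m ι : Type*} [Fintype m] (s : Finset ι) {f : ι → Matrix m m ℂ}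
    (h : ∀ i ∈ s, (f i).PosSemidef) : (∑ i ∈ s, f i).PosSemidef := by
  classical
  induction s using Finset.induction_on with
  | empty => simpa using Matrix.PosSemidef.zero
  | insert a s ha ih =>
    rw [Finset.sum_insert ha]
    exact (h a (Finset.mem_insert_self a s)).add (ih fun i hi => h i (Finset.mem_insert_of_mem hi))

/-- **The Casimir upper bound for `k` spins ½**: `𝐋² ≤ (k/2)(k/2 + 1) = k(k+2)/4`, i.e.
`(k(k+2)/4)·1 - Σ_α (L^α)² = Σ_{x≠y∈Y} (¼ - 𝐒_x·𝐒_y) ⪰ 0` — the total spin of `k` spins ½ is at most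
`k/2`. Tasaki (2020) §2.2, App. A.3; Lieb–Mattis (1962). [cite: Tasaki2020] -/
theorem posSemidef_casimirBound_sub (Y : Finset Λ) :
    ((((Y.card : ℂ) * (Y.card + 2) / 4) • (1 : Op Λ 2)) -
      ∑ α : Fin 3, (∑ x ∈ Y, siteSpin 1 x α) * (∑ x ∈ Y, siteSpin 1 x α)).PosSemidef := by
  have hcount : (∑ x ∈ Y, ∑ _y ∈ Y.erase x, ((1 / 4 : ℂ) • (1 : Op Λ 2))) =
      ((Y.card : ℂ) * (Y.card - 1) / 4) • (1 : Op Λ 2) := by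
    rw [Finset.sum_congr rfl fun x hx => by rw [Finset.sum_const, Finset.card_erase_of_mem hx],
      Finset.sum_const, smul_smul, ← Nat.cast_smul_eq_nsmul ℂ, smul_smul]
    congr 1
    have h1 : 1 ≤ Y.card ∨ Y.card = 0 := by omega
    rcases h1 with h1 | h0
    · rw [Nat.cast_mul, Nat.cast_sub h1]; push_cast; ring
    · simp [h0]
  have key : (((Y.card : ℂ) * (Y.card + 2) / 4) • (1 : Op Λ 2)) -
      ∑ α : Fin 3, (∑ x ∈ Y, siteSpin 1 x α) * (∑ x ∈ Y, siteSpin 1 x α) =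
      ∑ x ∈ Y, ∑ y ∈ Y.erase x, ((1 / 4 : ℂ) • (1 : Op Λ 2) - spinDot 1 x y) := by
    simp only [Finset.sum_sub_distrib]
    rw [hcount, sum_setSpin_one_mul_self, ← sub_sub, ← sub_smul]
    congr 2
    ring
  rw [key]
  exact posSemidef_finset_sum _ fun x hx => posSemidef_finset_sum _ fun y hy =>
    posSemidef_quarter_sub_spinDot_one (Finset.ne_of_mem_erase hy).symm

end Casimir

end Literature.MathematicalPhysics.QuantumLattice
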